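import Mathlib

/-!
# Solo-blind O1b, E75: the residual line `I/𝔪I` detects membership in `𝔪I`

Ring-theoretic core of the mechanism behind the GOVERNING CHARACTER LAW (G♮) of the solo-blind
Eisenstein study (`paper/theoremPhi.md` §5(p)).  There `T` is the local Hecke algebra, `I` its
Eisenstein ideal, and modulo `𝔪I` the Hecke generator factors as `η_p ≡ r_p · x` with `x ∈ I` a
fixed element whose class spans a line of `I/𝔪I` and `r_p ≡ ψ(p)(1 - p)`; the law
"`η_p ∈ 𝔪I ⟺ ψ(p) = 0 ∨ p ≡ 1 (mod ℓ)`" is then the statement below: for `x ∈ I ∖ 𝔪I` in a local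
ring, `r x ∈ 𝔪I ⟺ r ∈ 𝔪`.
-/

namespace Summit.Langlands.Langlands.Theorems

/-- **E75a.** In a commutative local ring, if `x ∈ I` but `x ∉ 𝔪I`, then a multiple `r * x` lies in
`𝔪I` exactly when `r ∈ 𝔪`. -/
theorem soloBlind_mul_mem_maximalIdeal_mul_iff
    {R : Type*} [CommRing R] [IsLocalRing R] {I : Ideal R} {x : R}
    (hx : x ∈ I) (hx' : x ∉ IsLocalRing.maximalIdeal R * I) (r : R) :
    r * x ∈ IsLocalRing.maximalIdeal R * I ↔ r ∈ IsLocalRing.maximalIdeal R := by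
  constructor
  · intro h
    by_contra hr
    -- `r` is a unit, so `x = r⁻¹ (r x) ∈ 𝔪I`, contradiction
    have hu : IsUnit r := by
      simpa [IsLocalRing.mem_maximalIdeal, mem_nonunits_iff] using hr
    obtain ⟨u, rfl⟩ := hu
    apply hx'
    have : (↑u⁻¹ : R) * (↑u * x) ∈ IsLocalRing.maximalIdeal R * I :=
      Ideal.mul_mem_left _ _ h
    simpa [← mul_assoc] using this
  · intro hr
    exact Ideal.mul_mem_mul hr hx

/-- **E75b.** Same setting, product form: if `x ∈ I ∖ 𝔪I` and `s ∈ R`, then `(s * r) * x ∈ 𝔪I`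
iff `s ∈ 𝔪` or `r ∈ 𝔪` — the shape `η_p ≡ ψ(p) · (1 - p) · x` of the governing character law
(`s = ψ(p)`-lift, `r = 1 - p`). -/
theorem soloBlind_mul_mul_mem_maximalIdeal_mul_iff
    {R : Type*} [CommRing R] [IsLocalRing R] {I : Ideal R} {x : R}
    (hx : x ∈ I) (hx' : x ∉ IsLocalRing.maximalIdeal R * I) (s r : R) :
    s * r * x ∈ IsLocalRing.maximalIdeal R * I ↔
      s ∈ IsLocalRing.maximalIdeal R ∨ r ∈ IsLocalRing.maximalIdeal R := by
  rw [soloBlind_mul_mem_maximalIdeal_mul_iff hx hx' (s * r)]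
  exact Ideal.IsPrime.mul_mem_iff_mem_or_mem inferInstance

end Summit.Langlands.Langlands.Theorems
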